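import Literature.Geometry.Riemannian.AHChartConvexity
import Literature.Geometry.Riemannian.AHChartConstants
import Literature.Geometry.Riemannian.RiemannianCoveringCriterion
import Literature.Geometry.Lorentzian.IsometryProofs
import Literature.Geometry.Lorentzian.GeodesicProofs
import Literature.Geometry.Lorentzian.LeviCivitaProofs
import Mathlib.Geometry.Manifold.IsManifold.InteriorBoundary
import Mathlib.Geometry.Manifold.SmoothEmbedding
import Mathlib.Geometry.Manifold.MFDeriv.Atlas
import HarnessLib

/-!
# Convexity near infinity of an asymptotically hyperbolic metric (manifold layer)

Support file (everything proved, no definitions, no named facts) for the discharge of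
`Literature.Geometry.Riemannian.ggsu_boundary_sphere_of_nonTrapping_of_nonpos`
(`SimpleAHBoundarySphere.lean`; Graham–Guillarmou–Stefanov–Uhlmann, Ann. Inst. Fourier 69 (2019),
p. 10: "the regions `{ρ ≥ ε}` are strictly convex with respect to the flow for `ε > 0` small
enough").

In the setting of the named fact (`j : N → X` a smooth embedding of the AH manifold `(N, g)` onto
the interior of the compact manifold with boundary `X`, `ρ` a boundary defining function,
`j^* ḡ = (ρ ∘ j)² g`, `|dρ|_ḡ = 1` on `∂X`) we prove
`SimpleAH.exists_convexity_threshold`: **there is `ε₀ > 0` such that for every `g`-geodesic `γ`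
and every parameter `t` with `g(γ' t, γ' t) = 1`, `ρ(j(γ t)) < ε₀` and `(ρ ∘ j ∘ γ)'(t) = 0` one has
`(ρ ∘ j ∘ γ)''(t) < 0`** — the level sets `{ρ = ε}`, `ε < ε₀`, are strictly convex from the
interior. Proof: read `g` in a boundary chart `φ` of `X` at `z ∈ ∂X` (the pulled-back metric
`ψ^* g`, `ψ = j⁻¹ ∘ φ⁻¹`, on an open subset of the model space; its components are `ρ̂⁻² Q` with
`ρ̂ = ρ ∘ φ⁻¹` and `Q` the compactified metric in the chart), transfer the geodesic through `ψ`
(existence of the chart geodesic and uniqueness in `N`), and apply the coordinate estimate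
`SimpleAH.deriv_deriv_comp_geodesic_neg` (`AHChartConvexity.lean`) with the uniform constants of
`SimpleAH.exists_chart_constants` (`AHChartConstants.lean`); finitely many charts cover `∂X` and a
collar `{ρ < ε₁}`.

## References

* C. R. Graham, C. Guillarmou, P. Stefanov, G. Uhlmann, *X-ray transform and boundary rigidity
  for asymptotically hyperbolic manifolds*, Ann. Inst. Fourier 69 (2019), p. 10 (Lemma 2.3 and
  the remark following it). [GrahamEtAl2020]
* B. O'Neill, *Semi-Riemannian geometry* (1983), Ch. 3, Cor. 3.21, Lemma 3.22, pp. 90–91.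
  [ONeill1983]
-/

noncomputable section

open Bundle Set Filter Function Metric TopologicalSpace
open scoped Manifold ContDiff Topology

namespace Literature.Geometry.Riemannian

namespace SimpleAH

open Literature.Geometry.Lorentzian
open Literature.Geometry.Lorentzian.PseudoRiemannianMetric

set_option maxSynthPendingDepth 3

/-! ### Reading functions and metrics in an extended chart -/

section ChartReading

variable {E : Type*} [NormedAddCommGroup E] [NormedSpace ℝ E] {H' : Type*} [TopologicalSpace H']
  {I' : ModelWithCorners ℝ E H'} {X : Type*} [TopologicalSpace X] [ChartedSpace H' X]
  [IsManifold I' ∞ X] {n' : ℕ∞ω}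

omit [IsManifold I' ∞ X] in
/-- A `C^k` real function read in an extended chart is `C^k` within the model range at the chart
point. [folklore] -/
theorem contDiffWithinAt_comp_extChartAt_symm {k : ℕ∞ω} {ρ : X → ℝ} {z : X}
    (hρ : ContMDiffAt I' 𝓘(ℝ, ℝ) k ρ z) :
    ContDiffWithinAt ℝ k (ρ ∘ (extChartAt I' z).symm) (range I') (extChartAt I' z z) := by
  have h := (contMDiffAt_iff.1 hρ).2
  simp only [mfld_simps] at h
  exact h.congr (fun y _ ↦ rfl) rfl

/-- A `C^k` metric read in an extended chart: the coordinate expression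
`x̂ ↦ ((a, b) ↦ g_x(τ_x⁻¹ a, τ_x⁻¹ b))`, `x = φ⁻¹ x̂`, `τ` the trivialization of `TX` at the chart
centre, is `C^k` within the model range at the chart point. [folklore] -/
theorem contDiffWithinAt_metricInChart
    (g : PseudoRiemannianMetric I' n' E (TangentSpace I' : X → Type _)) (z : X) :
    ContDiffWithinAt ℝ n'
      ((fun x : X ↦ (ContinuousLinearMap.precomp ℝ
          ((trivializationAt E (TangentSpace I') z).symmL ℝ x)).comp
            ((g.val x).comp ((trivializationAt E (TangentSpace I') z).symmL ℝ x))) ∘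
        (extChartAt I' z).symm) (range I') (extChartAt I' z z) := by
  have h1 := (contMDiffAt_bilin_iff (IX := I') (IB := I') (F := E) (V := (TangentSpace I' : X → Type _))
    (b := id) (s := g.val) (x₀ := z)).1 (g.contMDiff z)
  have h2 := (contMDiffAt_iff.1 h1.2).2
  simp only [mfld_simps] at h2
  exact h2.congr (fun y _ ↦ rfl) rfl

/-- At an interior point of the chart target, the differential of the inverse extended chart is
the inverse trivialization of the tangent bundle (Mathlib's `TangentBundle.symmL_trivializationAt`,
with the within-derivative upgraded to a derivative). [folklore] -/
theorem mfderiv_extChartAt_symm_apply_eq_symmL {z : X} {p : E}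
    (hp : p ∈ interior (extChartAt I' z).target) (a : E) :
    mfderiv 𝓘(ℝ, E) I' (extChartAt I' z).symm p a =
      (trivializationAt E (TangentSpace I') z).symmL ℝ ((extChartAt I' z).symm p) a := by
  have hpt : p ∈ (extChartAt I' z).target := interior_subset hp
  have hx : (extChartAt I' z).symm p ∈ (chartAt H' z).source := by
    rw [← extChartAt_source I']
    exact (extChartAt I' z).map_target hpt
  have h := TangentBundle.symmL_trivializationAt (I := I') (𝕜 := ℝ) hx
  rw [(extChartAt I' z).right_inv hpt] at h
  have hnhds : range I' ∈ 𝓝 p :=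
    Filter.mem_of_superset (mem_interior_iff_mem_nhds.1 hp) (extChartAt_target_subset_range z)
  rw [mfderivWithin_of_mem_nhds hnhds] at h
  exact (congrArg (fun L ↦ L a) h).symm

/-- The inverse trivialization of the tangent bundle at its own base point is the identity.
[folklore] -/
theorem symmL_trivializationAt_self (z : X) (a : E) :
    (trivializationAt E (TangentSpace I') z).symmL ℝ z a = a := by
  have h := TangentBundle.symmL_trivializationAt (I := I') (𝕜 := ℝ) (mem_chart_source H' z)
  rw [mfderivWithin_range_extChartAt_symm] at h
  exact congrArg (fun L ↦ L a) h

omit [IsManifold I' ∞ X] in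
/-- The manifold derivative of a real function at a point, read in the extended chart:
`dρ_z(a) = D_{range I}(ρ ∘ φ⁻¹)(φ z)(a)`. [folklore] -/
theorem mfderiv_eq_fderivWithin_comp_symm {ρ : X → ℝ} {z : X}
    (hρ : MDifferentiableAt I' 𝓘(ℝ, ℝ) ρ z) (a : TangentSpace I' z) :
    mfderiv I' 𝓘(ℝ, ℝ) ρ z a =
      fderivWithin ℝ (ρ ∘ (extChartAt I' z).symm) (range I') (extChartAt I' z z) a := by
  rw [hρ.mfderiv]
  simp only [writtenInExtChartAt, mfld_simps]
  rfl

end ChartReading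

/-! ### Transfer of geodesics through an equidimensional immersion -/

section Locality

variable {E : Type*} [NormedAddCommGroup E] [NormedSpace ℝ E] {H : Type*} [TopologicalSpace H]
  {I : ModelWithCorners ℝ E H} {M : Type*} [TopologicalSpace M] [ChartedSpace H M]
  [IsManifold I ∞ M] [FiniteDimensional ℝ E]
  {cov : CovariantDerivative I E (TangentSpace I : M → Type _)}

/-- **Locality of the covariant derivative along a curve in the field**: `DW/dt (t₀)` only
depends on the germ of `W` at `t₀` (the canonical-frame formula differentiates the coefficient
functions `t ↦ cⁱ(W t)` at `t₀`). O'Neill 1983, Ch. 3, Prop. 3.18. [cite: ONeill1983, Ch. 3, Prop. 3.18] -/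
theorem covariantDerivAlong_congr_field {γ : ℝ → M} {W W' : Π t : ℝ, TangentSpace I (γ t)}
    {t₀ : ℝ} (h : ∀ᶠ t in 𝓝 t₀, W' t = W t) :
    covariantDerivAlong cov γ W' t₀ = covariantDerivAlong cov γ W t₀ := by
  simp only [covariantDerivAlong, covariantDerivAlongFrame]
  have h0 : W' t₀ = W t₀ := h.self_of_nhds
  congr 1
  · refine Finset.sum_congr rfl fun i _ ↦ ?_
    congr 1
    apply Filter.EventuallyEq.deriv_eq
    filter_upwards [h] with t ht
    rw [ht]
  · rw [h0]

omit [IsManifold I ∞ M] [FiniteDimensional ℝ E] in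
/-- Velocity of a translate: `(s ↦ γ(s + a))'(s₀) = γ'(s₀ + a)` when `γ` is differentiable at
`s₀ + a`. [folklore] -/
theorem velocity_comp_add_const {γ : ℝ → M} {a s₀ : ℝ}
    (hγ : MDifferentiableAt 𝓘(ℝ, ℝ) I γ (s₀ + a)) :
    velocity I (fun s ↦ γ (s + a)) s₀ = velocity I γ (s₀ + a) := by
  have hτ : HasMFDerivAt 𝓘(ℝ, ℝ) 𝓘(ℝ, ℝ) (fun s : ℝ ↦ s + a) s₀ (ContinuousLinearMap.id ℝ ℝ) :=
    hasMFDerivAt_iff_hasFDerivAt.2 ((hasFDerivAt_id (s₀ : ℝ)).add_const a)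
  have h := hγ.hasMFDerivAt.comp s₀ hτ
  have h' : mfderiv 𝓘(ℝ, ℝ) I (fun s ↦ γ (s + a)) s₀ =
      (mfderiv 𝓘(ℝ, ℝ) I γ (s₀ + a)).comp (ContinuousLinearMap.id ℝ ℝ) := h.mfderiv
  unfold velocity
  rw [h']
  rfl

omit [IsManifold I ∞ M] [FiniteDimensional ℝ E] in
/-- Transfer of first and second derivatives along `f (s + t₀) = F s` near `s = 0`. [folklore] -/
theorem deriv_deriv_eq_of_comp_add {f F : ℝ → ℝ} {t₀ : ℝ} (h : ∀ᶠ s in 𝓝 (0 : ℝ), f (s + t₀) = F s) :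
    deriv f t₀ = deriv F 0 ∧ deriv (deriv f) t₀ = deriv (deriv F) 0 := by
  have h' : (fun s ↦ f (s + t₀)) =ᶠ[𝓝 0] F := h
  have hd : deriv (fun s ↦ f (s + t₀)) = fun s ↦ deriv f (s + t₀) := by
    funext s
    exact deriv_comp_add_const _ _ _
  refine ⟨?_, ?_⟩
  · have h1 := h'.deriv_eq
    rw [hd] at h1
    simpa using h1
  · have h2 : deriv (fun s ↦ f (s + t₀)) =ᶠ[𝓝 0] deriv F :=
      h'.eventuallyEq_nhds.mono fun s hs ↦ hs.deriv_eq
    have h3 := h2.deriv_eq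
    rw [hd] at h3
    have h4 : deriv (fun s ↦ deriv f (s + t₀)) (0 : ℝ) = deriv (deriv f) (0 + t₀) :=
      deriv_comp_add_const _ _ _
    rw [h4, zero_add] at h3
    exact h3

end Locality

section Transfer

variable {E : Type*} [NormedAddCommGroup E] [NormedSpace ℝ E] {H : Type*} [TopologicalSpace H]
  {I : ModelWithCorners ℝ E H} {M : Type*} [TopologicalSpace M] [ChartedSpace H M]
  [IsManifold I ∞ M]
  {E' : Type*} [NormedAddCommGroup E'] [NormedSpace ℝ E'] {H' : Type*} [TopologicalSpace H']
  {I' : ModelWithCorners ℝ E' H'} {N : Type*} [TopologicalSpace N] [ChartedSpace H' N]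
  [IsManifold I' ∞ N]
  [FiniteDimensional ℝ E] [FiniteDimensional ℝ E'] [CompleteSpace E] [CompleteSpace E']
  [T2Space M] [T2Space N] [I.Boundaryless] [I'.Boundaryless]
  {g : PseudoRiemannianMetric I ∞ E (TangentSpace I : M → Type _)} [g.HasLeviCivita]
  {f : N → M} {hpb : contMDiff_pullbackBilin I M I' N ∞} {hf : ContMDiff I' I (∞ + 1) f}
  {hf' : ∀ u, Injective (mfderiv I' I f u)} {hdim : Module.finrank ℝ E' = Module.finrank ℝ E}
  [(g.comap hpb f hf hf' hdim).HasLeviCivita]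
  [CovariantDerivative.ContMDiffCovariantDerivative g.leviCivita 1]
  [CovariantDerivative.ContMDiffCovariantDerivative (g.comap hpb f hf hf' hdim).leviCivita 1]

omit [CompleteSpace E] [T2Space M] [T2Space N] [I.Boundaryless] [I'.Boundaryless]
  [CovariantDerivative.ContMDiffCovariantDerivative g.leviCivita 1]
  [CovariantDerivative.ContMDiffCovariantDerivative (g.comap hpb f hf hf' hdim).leviCivita 1] in
/-- **`f : (N, f^*g) → (M, g)` maps geodesics to geodesics**, on an open parameter set (the tree's
`CartanHadamard.isGeodesic_comp`, localised): if `c` is an `f^*g`-geodesic on the open set `s`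
then `t ↦ f (c t)` is a `g`-geodesic on `s`, with velocity `df(c')` there. O'Neill 1983, Ch. 3,
pp. 90–91 (local isometries preserve geodesics). [cite: ONeill1983, Ch. 3, pp. 90–91] -/
theorem isGeodesicOn_comp {c : ℝ → N} {s : Set ℝ} (hs : IsOpen s)
    (hc : IsGeodesicOn (g.comap hpb f hf hf' hdim).leviCivita c s) :
    IsGeodesicOn g.leviCivita (fun t ↦ f (c t)) s ∧
      ∀ t ∈ s, velocity I (fun t ↦ f (c t)) t = mfderiv I' I f (c t) (velocity I' c t) := by
  have hfs : ContMDiff I' I ∞ f := hf.of_le le_self_add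
  have hfd : ∀ y, MDifferentiableAt I' I f y := fun y ↦ (hfs y).mdifferentiableAt (by simp)
  have hcd : ∀ t ∈ s, MDifferentiableAt 𝓘(ℝ, ℝ) I' c t :=
    fun t ht ↦ IsGeodesicOn.mdifferentiableAt_holds hc ht
  have hvel : ∀ t ∈ s, velocity I (fun t ↦ f (c t)) t = mfderiv I' I f (c t) (velocity I' c t) :=
    fun t ht ↦ CartanHadamard.velocity_comp_apply (hfd (c t)) (hcd t ht)
  refine ⟨⟨fun t ht ↦ ?_, fun t ht ↦ ?_⟩, hvel⟩
  · -- near `t`, the tangent lift of `f ∘ c` is `tangentMap f` of the tangent lift of `c`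
    have htm : ContMDiff I'.tangent I.tangent ∞ (tangentMap I' I f) :=
      hf.contMDiff_tangentMap le_rfl
    have heq : tangentLift I (fun t ↦ f (c t)) =ᶠ[𝓝 t]
        fun t' ↦ tangentMap I' I f (tangentLift I' c t') := by
      filter_upwards [hs.mem_nhds ht] with t' ht'
      rw [tangentLift, TotalSpace.ext_iff]
      exact ⟨rfl, by rw [hvel t' ht']; rfl⟩
    exact (((htm _).mdifferentiableAt (by simp)).comp t (hc.1 t ht)).congr_of_eventuallyEq heq
  · have hnat := g.mfderiv_covariantDerivAlong_comap hpb hf hf' hdim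
      (γ := c) (W := fun s ↦ velocity I' c s) (t₀ := t) (hc.1 t ht)
    rw [hc.2 t ht, map_zero] at hnat
    have hW : ∀ᶠ t' in 𝓝 t, velocity I (fun t ↦ f (c t)) t' =
        mfderiv I' I f (c t') (velocity I' c t') := by
      filter_upwards [hs.mem_nhds ht] with t' ht'
      exact hvel t' ht'
    show covariantDerivAlong g.leviCivita (fun t ↦ f (c t))
      (fun s ↦ velocity I (fun t ↦ f (c t)) s) t = 0
    rw [covariantDerivAlong_congr_field (cov := g.leviCivita) (γ := fun t ↦ f (c t))
      (W := fun s ↦ mfderiv I' I f (c s) (velocity I' c s)) hW]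
    exact hnat.symm

/-- **Transfer of a geodesic through `f`.** Let `γ` be an entire `g`-geodesic in `M` and
`f p = γ t₀`. Then there are an open interval `D ∋ 0` and an `f^*g`-geodesic `c` on `D` with
`c 0 = p`, `(f^*g)(c'0, c'0) = g(γ' t₀, γ' t₀)` and `γ (s + t₀) = f (c s)` for `s ∈ D` (the maximal
`f^*g`-geodesic with initial data `(p, (df_p)⁻¹ γ'(t₀))`, and uniqueness of `g`-geodesics).
O'Neill 1983, Ch. 3, Lemma 3.22 and pp. 90–91. [cite: ONeill1983, Ch. 3, Lemma 3.22] -/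
theorem exists_geodesic_lift {γ : ℝ → M} (hγ : IsGeodesic g.leviCivita γ) (t₀ : ℝ) {p : N}
    (hp : f p = γ t₀) :
    ∃ (c : ℝ → N) (D : Set ℝ), IsOpen D ∧ D.OrdConnected ∧ (0 : ℝ) ∈ D ∧
      IsGeodesicOn (g.comap hpb f hf hf' hdim).leviCivita c D ∧ c 0 = p ∧
      (g.comap hpb f hf hf' hdim).val (c 0) (velocity I' c 0) (velocity I' c 0) =
        g.val (γ t₀) (velocity I γ t₀) (velocity I γ t₀) ∧
      ∀ s ∈ D, γ (s + t₀) = f (c s) := by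
  set gN := g.comap hpb f hf hf' hdim with hgN
  set V : E := velocity I γ t₀ with hV
  set L := mfderivEquivOfInjective (I := I) (I' := I') f p (hf' p) hdim with hL
  set w : E' := L.symm V with hw
  have hLw : mfderiv I' I f p (show TangentSpace I' p from w) = V :=
    mfderiv_mfderivEquivOfInjective_symm f p (hf' p) hdim V
  obtain ⟨hmax, h0D, hc0, hcv⟩ :=
    maximalGeodesic_spec (hasMaximalGeodesic (cov := gN.leviCivita) p (show TangentSpace I' p from w))
  set c := maximalGeodesic gN.leviCivita p (show TangentSpace I' p from w) with hc_def
  set D := maximalGeodesicDomain gN.leviCivita p (show TangentSpace I' p from w) with hD_def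
  have hDo : IsOpen D := hmax.1
  have hDoc : D.OrdConnected := hmax.2.1
  have hcD : IsGeodesicOn gN.leviCivita c D := hmax.2.2.1
  obtain ⟨hfc, hfcv⟩ := isGeodesicOn_comp (hpb := hpb) (hf := hf) (hf' := hf') (hdim := hdim)
    hDo hcD
  -- the translate `s ↦ γ (s + t₀)` is a geodesic
  have hγd : ∀ t, MDifferentiableAt 𝓘(ℝ, ℝ) I γ t :=
    fun t ↦ IsGeodesicOn.mdifferentiableAt_holds hγ (mem_univ t)
  have hγs : IsGeodesicOn g.leviCivita (fun s ↦ γ (s + t₀)) D := by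
    have h := IsGeodesicOn.comp_affine_holds (cov := g.leviCivita) hγ 1 t₀
    rw [preimage_univ] at h
    have hfun : (fun t ↦ γ (1 * t + t₀)) = fun s ↦ γ (s + t₀) := by
      funext t; rw [one_mul]
    rw [hfun] at h
    exact h.mono (subset_univ D)
  -- same initial data at `0`
  have hpos0 : (fun s ↦ γ (s + t₀)) 0 = (fun t ↦ f (c t)) 0 := by
    show γ (0 + t₀) = f (c 0)
    rw [zero_add, hc0, hp]
  have hvel0 : velocity I (fun s ↦ γ (s + t₀)) 0 = velocity I (fun t ↦ f (c t)) 0 := by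
    rw [velocity_comp_add_const (by rw [zero_add]; exact hγd t₀), hfcv 0 h0D]
    rw [zero_add]
    have h1 : (mfderiv I' I f (c 0) (velocity I' c 0) : E) = mfderiv I' I f p (velocity I' c 0) :=
      CartanHadamard.mfderiv_congr_point (I := I) (I' := I') hc0 _
    rw [h1, hcv, hLw]
  have heq : EqOn (fun s ↦ γ (s + t₀)) (fun t ↦ f (c t)) D :=
    IsGeodesicOn.eqOn_of_velocity_eq_holds hDo hDoc hγs hfc h0D hpos0 hvel0
  refine ⟨c, D, hDo, hDoc, h0D, hcD, hc0, ?_, fun s hs ↦ heq hs⟩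
  -- the speed
  have key : ∀ (q : N) (hq : q = p) (u : E') (hu : u = w),
      gN.val q (show TangentSpace I' q from u) (show TangentSpace I' q from u) =
        g.val (γ t₀) V V := by
    intro q hq u hu
    subst hq; subst hu
    rw [hgN, PseudoRiemannianMetric.val_comap, pullbackBilin_apply, hLw, hp]
  exact key (c 0) hc0 (velocity I' c 0) hcv

end Transfer


/-! ### Convexity near a boundary point -/

section PerPoint

variable {n : ℕ}
  {N : Type*} [TopologicalSpace N] [T2Space N] [ChartedSpace (EuclideanSpace ℝ (Fin (n + 1))) N]
  [IsManifold (𝓡 (n + 1)) ∞ N]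
  {X : Type*} [TopologicalSpace X] [T2Space X] [ChartedSpace (EuclideanHalfSpace (n + 1)) X]
  [IsManifold (𝓡∂ (n + 1)) ∞ X]

/-- The differential of the inclusion of an open subset of a normed space is the identity.
[folklore] -/
theorem mfderiv_subtype_val_apply {F : Type*} [NormedAddCommGroup F] [NormedSpace ℝ F]
    {U : Opens F} (p : U) (a : F) :
    mfderiv 𝓘(ℝ, F) 𝓘(ℝ, F) (Subtype.val : U → F) p a = a := by
  rw [← OpensChart.extChartAt_coe p]
  exact OpensChart.mfderiv_extChartAt_apply p a

omit [T2Space X] in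
/-- Interior points of a manifold with boundary, read in the extended chart at any point of whose
chart domain they lie (Mathlib's chart-independence of the interior). [folklore] -/
theorem isInteriorPoint_iff_extChartAt {z x : X} (hx : x ∈ (chartAt (EuclideanHalfSpace (n + 1)) z).source) :
    (𝓡∂ (n + 1)).IsInteriorPoint x ↔
      extChartAt (𝓡∂ (n + 1)) z x ∈ interior (extChartAt (𝓡∂ (n + 1)) z).target :=
  (𝓡∂ (n + 1)).isInteriorPoint_iff_of_mem_atlas (n := ∞) (by simp) (chart_mem_atlas _ z) hx
set_option maxHeartbeats 400000 in -- buildfix (bf3-g26): 160k/180k FAIL, 200k PASS at accept time; line-neutral budget line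
omit [T2Space X] in
/-- **Convexity near infinity, near one boundary point** (GGSU 2019, p. 10). In the setting of the
named fact (`j : N → X` a smooth embedding onto the interior, `ρ` a boundary defining function,
`j^* ḡ = (ρ ∘ j)² g`), let `z ∈ X` carry a vector `ν` with `ḡ(ν, ν) = 1` and `ḡ(ν, ·) = dρ_z`. Then
there are an open `V ∋ z` and `κ > 0` such that for every `g`-geodesic `γ` and every `t₀` with
`j (γ t₀) ∈ V`, `g(γ' t₀, γ' t₀) = 1`, `ρ(j(γ t₀)) < κ` and `(ρ ∘ j ∘ γ)'(t₀) = 0` one has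
`(ρ ∘ j ∘ γ)''(t₀) < 0`. Proof: read `g` in the chart at `z` (pull back along
`ψ = j⁻¹ ∘ φ⁻¹`, components `ρ̂⁻² Q`), transfer `γ` to a chart geodesic (`exists_geodesic_lift`) and
apply `deriv_deriv_comp_geodesic_neg` with the constants of `exists_chart_constants`.
[cite: GrahamEtAl2020, p. 10] -/
theorem convexity_near_point
    (G : PseudoRiemannianMetric (𝓡 (n + 1)) ∞ (EuclideanSpace ℝ (Fin (n + 1)))
      (TangentSpace (𝓡 (n + 1)) : N → Type _)) [G.HasLeviCivita]
    [CovariantDerivative.ContMDiffCovariantDerivative G.leviCivita 1]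
    (gb : PseudoRiemannianMetric (𝓡∂ (n + 1)) ∞ (EuclideanSpace ℝ (Fin (n + 1)))
      (TangentSpace (𝓡∂ (n + 1)) : X → Type _)) (hgb : gb.IsRiemannian)
    {j : N → X} (hj : Manifold.IsSmoothEmbedding (𝓡 (n + 1)) (𝓡∂ (n + 1)) ∞ j)
    (hjr : range j = (𝓡∂ (n + 1)).interior X)
    {ρ : X → ℝ} (hρ : ContMDiff (𝓡∂ (n + 1)) 𝓘(ℝ, ℝ) ∞ ρ) (hρ0 : ∀ x, 0 ≤ ρ x)
    (hρb : ∀ x, ρ x = 0 ↔ x ∈ (𝓡∂ (n + 1)).boundary X)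
    (hconf : ∀ (x : N) (v w : TangentSpace (𝓡 (n + 1)) x),
      gb.val (j x) (mfderiv (𝓡 (n + 1)) (𝓡∂ (n + 1)) j x v) (mfderiv (𝓡 (n + 1)) (𝓡∂ (n + 1)) j x w)
        = ρ (j x) ^ 2 * G.val x v w)
    {z : X} {ν : TangentSpace (𝓡∂ (n + 1)) z} (hν1 : gb.val z ν ν = 1)
    (hν2 : ∀ a : TangentSpace (𝓡∂ (n + 1)) z, gb.val z ν a = mfderiv (𝓡∂ (n + 1)) 𝓘(ℝ, ℝ) ρ z a) :
    ∃ V : Set X, IsOpen V ∧ z ∈ V ∧ ∃ κ : ℝ, 0 < κ ∧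
      ∀ γ : ℝ → N, IsGeodesic G.leviCivita γ → ∀ t₀ : ℝ, j (γ t₀) ∈ V →
        G.val (γ t₀) (velocity (𝓡 (n + 1)) γ t₀) (velocity (𝓡 (n + 1)) γ t₀) = 1 →
        ρ (j (γ t₀)) < κ → deriv (fun t ↦ ρ (j (γ t))) t₀ = 0 →
        deriv (deriv fun t ↦ ρ (j (γ t))) t₀ < 0 := by
  -- notation
  set φ := extChartAt (𝓡∂ (n + 1)) z with hφ
  set e := trivializationAt (EuclideanSpace ℝ (Fin (n + 1))) (TangentSpace (𝓡∂ (n + 1)) : X → Type _) z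
    with he
  set x₀ : EuclideanSpace ℝ (Fin (n + 1)) := φ z with hx₀
  set S : Set (EuclideanSpace ℝ (Fin (n + 1))) := φ.target with hS
  set rh : EuclideanSpace ℝ (Fin (n + 1)) → ℝ := fun q ↦ ρ (φ.symm q) with hrh
  set Q : EuclideanSpace ℝ (Fin (n + 1)) →
      EuclideanSpace ℝ (Fin (n + 1)) →L[ℝ] EuclideanSpace ℝ (Fin (n + 1)) →L[ℝ] ℝ :=
    fun q ↦ (ContinuousLinearMap.precomp ℝ (e.symmL ℝ (φ.symm q))).comp
      ((gb.val (φ.symm q)).comp (e.symmL ℝ (φ.symm q))) with hQ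
  have hQapp : ∀ (q a b : EuclideanSpace ℝ (Fin (n + 1))),
      Q q a b = gb.val (φ.symm q) (e.symmL ℝ (φ.symm q) a) (e.symmL ℝ (φ.symm q) b) := by
    intro q a b
    simp only [hQ, ContinuousLinearMap.comp_apply, ContinuousLinearMap.precomp_apply]
  have hx₀S : x₀ ∈ S := mem_extChartAt_target z
  have hSrange : S ⊆ range (𝓡∂ (n + 1)) := extChartAt_target_subset_range z
  have hsymm_src : ∀ q ∈ S, φ.symm q ∈ (chartAt (EuclideanHalfSpace (n + 1)) z).source := by
    intro q hq
    rw [← extChartAt_source (𝓡∂ (n + 1))]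
    exact φ.map_target hq
  -- basic facts on the symmL of the trivialization over the chart domain
  have hsymmL_inj' : ∀ {x : X} (hx : x ∈ (chartAt (EuclideanHalfSpace (n + 1)) z).source)
      {a b : EuclideanSpace ℝ (Fin (n + 1))}, e.symmL ℝ x a = e.symmL ℝ x b → a = b := by
    intro x hx a b hab
    have hxe : x ∈ e.baseSet := by rwa [he, TangentBundle.trivializationAt_baseSet]
    have h3 := congrArg (e.continuousLinearMapAt ℝ x) hab
    rwa [e.continuousLinearMapAt_symmL hxe, e.continuousLinearMapAt_symmL hxe] at h3
  have hsymmL_inj : ∀ {x : X} (hx : x ∈ (chartAt (EuclideanHalfSpace (n + 1)) z).source)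
      {a : EuclideanSpace ℝ (Fin (n + 1))}, e.symmL ℝ x a = 0 → a = 0 := by
    intro x hx a ha
    exact hsymmL_inj' hx (by rw [ha, map_zero])
  -- smoothness in the chart
  have hr1 : ContDiffWithinAt ℝ ∞ rh (range (𝓡∂ (n + 1))) x₀ := contDiffWithinAt_comp_extChartAt_symm (hρ z)
  have hQ1 : ContDiffWithinAt ℝ ∞ Q (range (𝓡∂ (n + 1))) x₀ := contDiffWithinAt_metricInChart gb z
  obtain ⟨U₁, hU₁o, hxU₁, hrU⟩ := hr1.contDiffOn' (m := 2) (WithTop.coe_le_coe.2 le_top) (by simp)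
  obtain ⟨U₂, hU₂o, hxU₂, hQU⟩ := hQ1.contDiffOn' (m := 1) (WithTop.coe_le_coe.2 le_top) (by simp)
  rw [insert_eq_of_mem (hSrange hx₀S)] at hrU hQU
  set U := U₁ ∩ U₂ with hU
  have hUo : IsOpen U := hU₁o.inter hU₂o
  have hxU : x₀ ∈ U := ⟨hxU₁, hxU₂⟩
  have hrSU : ContDiffOn ℝ 2 rh (S ∩ U) :=
    hrU.mono (inter_subset_inter hSrange inter_subset_left)
  have hQSU : ContDiffOn ℝ 1 Q (S ∩ U) :=
    hQU.mono (inter_subset_inter hSrange inter_subset_right)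
  -- positivity of `Q` on the chart target
  have hQpos : ∀ q ∈ S ∩ U, ∀ a : EuclideanSpace ℝ (Fin (n + 1)), a ≠ 0 → 0 < Q q a a := by
    intro q hq a ha
    rw [hQapp]
    exact hgb _ _ fun h0 ↦ ha (hsymmL_inj (hsymm_src q hq.1) h0)
  -- the data at the centre
  have hz : φ.symm x₀ = z := extChartAt_to_inv z
  have hν1' : Q x₀ ν ν = 1 := by
    rw [hQapp, hz, symmL_trivializationAt_self, hν1]
  have hν2' : fderivWithin ℝ rh S x₀ ν = 1 := by
    have hW : (𝓡∂ (n + 1)).symm ⁻¹' (chartAt (EuclideanHalfSpace (n + 1)) z).target ∈ 𝓝 x₀ := by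
      apply ((𝓡∂ (n + 1)).continuous_symm.isOpen_preimage _ (chartAt _ z).open_target).mem_nhds
      show (𝓡∂ (n + 1)).symm (φ z) ∈ (chartAt (EuclideanHalfSpace (n + 1)) z).target
      rw [hφ, extChartAt_coe, Function.comp_apply, (𝓡∂ (n + 1)).left_inv]
      exact (chartAt _ z).map_source (mem_chart_source _ z)
    rw [hS, hφ, extChartAt_target, inter_comm, fderivWithin_inter hW]
    have h2 := mfderiv_eq_fderivWithin_comp_symm ((hρ z).mdifferentiableAt (by simp)) ν
    rw [← hν2 ν, hν1] at h2
    exact h2.symm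
  -- the uniform constants
  obtain ⟨δ, m, c₀, C₁, C₂, Cr, hδ, hm, hc₀, hC₁0, hC₂0, hCr0, hpack⟩ :=
    exists_chart_constants (𝓡∂ (n + 1)).isClosed_range hSrange (uniqueDiffOn_extChartAt_target z) hx₀S
      (extChartAt_target_mem_nhdsWithin z) hUo hxU hrSU hQSU hQpos hν1' hν2'
  set κ : ℝ := c₀ * m / (C₂ + 2 * C₁ * Cr / m + 1) with hκ
  have hden : 0 < C₂ + 2 * C₁ * Cr / m + 1 := by positivity
  have hκpos : 0 < κ := div_pos (mul_pos hc₀ hm) hden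
  -- the neighbourhood `V`
  set V : Set X := φ.source ∩ φ ⁻¹' ball x₀ δ with hV
  have hVo : IsOpen V := isOpen_extChartAt_preimage' z isOpen_ball
  have hzV : z ∈ V := ⟨mem_extChartAt_source z, mem_ball_self hδ⟩
  refine ⟨V, hVo, hzV, κ, hκpos, fun γ hγ t₀ hγV hunit hlt htan ↦ ?_⟩
  haveI : Nonempty N := ⟨γ t₀⟩
  -- the open set `O` of the model space and the map `ψ = j⁻¹ ∘ φ⁻¹ : O → N`
  set O : Opens (EuclideanSpace ℝ (Fin (n + 1))) :=
    ⟨interior S ∩ ball x₀ δ, isOpen_interior.inter isOpen_ball⟩ with hO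
  have hOS : ∀ p : O, (p : EuclideanSpace ℝ (Fin (n + 1))) ∈ S := fun p ↦ interior_subset p.2.1
  have hOint : ∀ p : O, φ.symm p ∈ (𝓡∂ (n + 1)).interior X := by
    intro p
    have hsrc := hsymm_src p (hOS p)
    show (𝓡∂ (n + 1)).IsInteriorPoint (φ.symm p)
    rw [isInteriorPoint_iff_extChartAt hsrc, ← hφ, φ.right_inv (hOS p)]
    exact p.2.1
  have hOrange : ∀ p : O, φ.symm p ∈ range j := fun p ↦ by rw [hjr]; exact hOint p
  set ψ : O → N := fun p ↦ Function.invFun j (φ.symm p) with hψ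
  have hjψ : ∀ p : O, j (ψ p) = φ.symm p := fun p ↦ Function.invFun_eq (hOrange p)
  have hjψ' : (fun p : O ↦ j (ψ p)) = fun p : O ↦ φ.symm p := funext hjψ
  have hΦs : ContMDiff 𝓘(ℝ, EuclideanSpace ℝ (Fin (n + 1))) (𝓡∂ (n + 1)) ∞
      (fun p : O ↦ φ.symm (p : EuclideanSpace ℝ (Fin (n + 1)))) :=
    (contMDiffOn_extChartAt_symm z).comp_contMDiff contMDiff_subtype_val fun p ↦ hOS p
  have hje : Topology.IsEmbedding j := hj.isEmbedding
  have hψc : Continuous ψ := by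
    rw [hje.isInducing.continuous_iff, Function.comp_def, hjψ']
    exact hΦs.continuous
  have hψs : ContMDiff 𝓘(ℝ, EuclideanSpace ℝ (Fin (n + 1))) (𝓡 (n + 1)) ∞ ψ := by
    intro p
    refine (ContMDiffAt.iff_comp_isImmersionAt (hj.isImmersion.isImmersionAt (ψ p))).2
      ⟨hψc.continuousAt, ?_⟩
    rw [Function.comp_def, hjψ']
    exact hΦs p
  -- differentials: `dj (dψ a) = τ⁻¹ a`
  have hφsymm_d : ∀ p : O, MDifferentiableAt 𝓘(ℝ, EuclideanSpace ℝ (Fin (n + 1))) (𝓡∂ (n + 1)) φ.symm p := by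
    intro p
    have hSn : S ∈ 𝓝 (p : EuclideanSpace ℝ (Fin (n + 1))) := mem_interior_iff_mem_nhds.1 p.2.1
    exact ((contMDiffOn_extChartAt_symm (n := ∞) z _ (hOS p)).contMDiffAt hSn).mdifferentiableAt
      (by simp)
  have hdΦ : ∀ (p : O) (a : EuclideanSpace ℝ (Fin (n + 1))),
      mfderiv 𝓘(ℝ, EuclideanSpace ℝ (Fin (n + 1))) (𝓡∂ (n + 1))
        (fun p : O ↦ φ.symm (p : EuclideanSpace ℝ (Fin (n + 1)))) p a =
      e.symmL ℝ (φ.symm p) a := by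
    intro p a
    have hval : MDifferentiableAt 𝓘(ℝ, EuclideanSpace ℝ (Fin (n + 1)))
        𝓘(ℝ, EuclideanSpace ℝ (Fin (n + 1))) (Subtype.val : O → _) p :=
      (contMDiff_subtype_val (n := ∞) p).mdifferentiableAt (by simp)
    have hcomp := mfderiv_comp p (hφsymm_d p) hval
    have : (fun p : O ↦ φ.symm (p : EuclideanSpace ℝ (Fin (n + 1)))) = φ.symm ∘ Subtype.val := rfl
    rw [this, hcomp, ContinuousLinearMap.comp_apply, mfderiv_subtype_val_apply,
      mfderiv_extChartAt_symm_apply_eq_symmL p.2.1]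
  have hjd : ∀ x, MDifferentiableAt (𝓡 (n + 1)) (𝓡∂ (n + 1)) j x :=
    fun x ↦ (hj.contMDiff x).mdifferentiableAt (by simp)
  have hψd : ∀ p, MDifferentiableAt 𝓘(ℝ, EuclideanSpace ℝ (Fin (n + 1))) (𝓡 (n + 1)) ψ p :=
    fun p ↦ (hψs p).mdifferentiableAt (by simp)
  have hdψ : ∀ (p : O) (a : EuclideanSpace ℝ (Fin (n + 1))),
      mfderiv (𝓡 (n + 1)) (𝓡∂ (n + 1)) j (ψ p) (mfderiv 𝓘(ℝ, EuclideanSpace ℝ (Fin (n + 1))) (𝓡 (n + 1)) ψ p a)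
        = e.symmL ℝ (φ.symm p) a := by
    intro p a
    have hcomp := mfderiv_comp p (hjd (ψ p)) (hψd p)
    have h1 : mfderiv 𝓘(ℝ, EuclideanSpace ℝ (Fin (n + 1))) (𝓡∂ (n + 1)) (j ∘ ψ) p a =
        mfderiv (𝓡 (n + 1)) (𝓡∂ (n + 1)) j (ψ p) (mfderiv 𝓘(ℝ, _) (𝓡 (n + 1)) ψ p a) := by
      rw [hcomp]; rfl
    rw [← h1, Function.comp_def, hjψ', hdΦ]
  have hψ' : ∀ p, Injective (mfderiv 𝓘(ℝ, EuclideanSpace ℝ (Fin (n + 1))) (𝓡 (n + 1)) ψ p) := by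
    intro p a b hab
    have h := congrArg (mfderiv (𝓡 (n + 1)) (𝓡∂ (n + 1)) j (ψ p)) hab
    rw [hdψ, hdψ] at h
    exact hsymmL_inj' (hsymm_src _ (hOS p)) h
  -- the pulled-back metric on `O` and its components `Ĝ = ρ̂⁻² Q`
  have hpb : contMDiff_pullbackBilin (𝓡 (n + 1)) N 𝓘(ℝ, EuclideanSpace ℝ (Fin (n + 1))) O ∞ :=
    contMDiff_pullbackBilin_holds
  set gO := G.comap hpb ψ hψs hψ' rfl with hgO
  haveI : gO.HasLeviCivita := gO.hasLeviCivita
  have hk1 : ((1 : ℕ∞) : ℕ∞ω) + 1 ≤ ∞ := by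
    rw [show ((1 : ℕ∞) : ℕ∞ω) + 1 = 2 by norm_num]
    exact WithTop.coe_le_coe.2 le_top
  haveI : CovariantDerivative.ContMDiffCovariantDerivative gO.leviCivita 1 :=
    ⟨gO.isLocallyContMDiff_leviCivita_holds 1 hk1 univ isOpen_univ⟩
  set Gh : EuclideanSpace ℝ (Fin (n + 1)) →
      EuclideanSpace ℝ (Fin (n + 1)) →L[ℝ] EuclideanSpace ℝ (Fin (n + 1)) →L[ℝ] ℝ :=
    fun q ↦ ((rh q) ^ 2)⁻¹ • Q q with hGh
  have hGhconf : ∀ q, Gh q = ((rh q) ^ 2)⁻¹ • Q q := fun _ ↦ rfl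
  have hrhpos : ∀ p : O, 0 < rh p := by
    intro p
    have hnb : φ.symm p ∉ (𝓡∂ (n + 1)).boundary X := fun hb ↦
      Set.disjoint_left.1 ModelWithCorners.disjoint_interior_boundary (hOint p) hb
    exact lt_of_le_of_ne (hρ0 _) fun h0 ↦ hnb ((hρb _).1 h0.symm)
  have hGval : ∀ (p : O) (a b : EuclideanSpace ℝ (Fin (n + 1))),
      gO.val p a b = Gh p a b := by
    intro p a b
    have hc := hconf (ψ p) (mfderiv 𝓘(ℝ, _) (𝓡 (n + 1)) ψ p a) (mfderiv 𝓘(ℝ, _) (𝓡 (n + 1)) ψ p b)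
    rw [hdψ p a, hdψ p b, hjψ p] at hc
    -- `hc : Q p a b = (rh p)² * G(ψ p)(dψ a, dψ b)`
    have h1 : gO.val p a b = G.val (ψ p) (mfderiv 𝓘(ℝ, _) (𝓡 (n + 1)) ψ p a)
        (mfderiv 𝓘(ℝ, _) (𝓡 (n + 1)) ψ p b) := rfl
    have h2 : Gh p a b = ((rh p) ^ 2)⁻¹ * Q p a b := rfl
    rw [h1, h2, hQapp, hc]
    have hr0 : (rh p) ^ 2 ≠ 0 := pow_ne_zero 2 (hrhpos p).ne'
    show _ = (rh p ^ 2)⁻¹ * (ρ (φ.symm p) ^ 2 * _)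
    rw [show ρ (φ.symm p) = rh p from rfl, ← mul_assoc, inv_mul_cancel₀ hr0, one_mul]
  have hG : ∀ p : O, gO.val p = Gh p := fun p ↦
    ContinuousLinearMap.ext fun a ↦ ContinuousLinearMap.ext fun b ↦ hGval p a b
  have hQsymm : ∀ (q a b : EuclideanSpace ℝ (Fin (n + 1))), Q q a b = Q q b a := by
    intro q a b
    rw [hQapp, hQapp, gb.symm]
  have hGd : ∀ p : O, DifferentiableAt ℝ Gh p := by
    intro p
    obtain ⟨hrd, -, hQd, -⟩ := hpack p p.2
    exact differentiableAt_conformal hrd.self_of_nhds hQd (hrhpos p).ne' hGhconf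
  -- the point `p₁ = φ (j (γ t₀)) ∈ O`
  set x : X := j (γ t₀) with hx
  have hxsrc : x ∈ φ.source := hγV.1
  have hxsrc' : x ∈ (chartAt (EuclideanHalfSpace (n + 1)) z).source := by
    rwa [← extChartAt_source (𝓡∂ (n + 1))]
  have hxint : (𝓡∂ (n + 1)).IsInteriorPoint x := by
    show x ∈ (𝓡∂ (n + 1)).interior X
    rw [← hjr]
    exact mem_range_self _
  have hphat : φ x ∈ interior S ∩ ball x₀ δ :=
    ⟨(isInteriorPoint_iff_extChartAt hxsrc').1 hxint, hγV.2⟩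
  set p₁ : O := ⟨φ x, hphat⟩ with hp₁
  have hsymm_p₁ : φ.symm (p₁ : EuclideanSpace ℝ (Fin (n + 1))) = x := φ.left_inv hxsrc
  have hψp₁ : ψ p₁ = γ t₀ := hje.injective (by rw [hjψ, hsymm_p₁])
  -- transfer the geodesic
  obtain ⟨c, D, hDo, hDoc, h0D, hcD, hc0, hspeed, heqγ⟩ :=
    exists_geodesic_lift (g := G) (hpb := hpb) (hf := hψs) (hf' := hψ') (hdim := rfl) hγ t₀ hψp₁
  -- `ρ (j (γ (s + t₀))) = rh (c s)` near `s = 0`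
  have hfF : ∀ᶠ s in 𝓝 (0 : ℝ), ρ (j (γ (s + t₀))) = rh (c s) := by
    filter_upwards [hDo.mem_nhds h0D] with s hs
    rw [heqγ s hs, hjψ]
  obtain ⟨hd1, hd2⟩ := deriv_deriv_eq_of_comp_add (f := fun t ↦ ρ (j (γ t)))
    (F := fun s ↦ rh (c s)) hfF
  rw [hd2]
  rw [hd1] at htan
  -- `rh (c 0) = ρ (j (γ t₀))`
  have hval0 : rh (c 0) = ρ (j (γ t₀)) := by
    have h := hfF.self_of_nhds
    rw [zero_add] at h
    exact h.symm
  -- the hypotheses of the chart estimate at `c 0`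
  obtain ⟨hrd, hr2, hQd, hmQ, hC₁, hC₂, hCr, hQν, hνc⟩ := hpack (c 0) (c 0).2
  have hunit' : Gh (c 0) (velocity 𝓘(ℝ, EuclideanSpace ℝ (Fin (n + 1))) c 0)
      (velocity 𝓘(ℝ, EuclideanSpace ℝ (Fin (n + 1))) c 0) = 1 := by
    rw [← hGval, hspeed, hunit]
  have hsmall : rh (c 0) < c₀ * m / (C₂ + 2 * C₁ * Cr / m + 1) := by rw [hval0]; exact hlt
  exact deriv_deriv_comp_geodesic_neg (g := gO) hG hGd hDo hcD h0D hrd hr2 hQd hGhconf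
    (hrhpos (c 0)) hQsymm hm hmQ hC₁ hC₂ hCr hc₀ hQν hνc hunit' htan hsmall

end PerPoint

/-! ### Globalization: a uniform threshold by compactness of the boundary -/

section Global

variable {n : ℕ}
  {N : Type*} [TopologicalSpace N] [T2Space N] [ChartedSpace (EuclideanSpace ℝ (Fin (n + 1))) N]
  [IsManifold (𝓡 (n + 1)) ∞ N]
  {X : Type*} [TopologicalSpace X] [ChartedSpace (EuclideanHalfSpace (n + 1)) X]
  [IsManifold (𝓡∂ (n + 1)) ∞ X] [CompactSpace X]

omit [ChartedSpace (EuclideanHalfSpace (n + 1)) X] [IsManifold (𝓡∂ (n + 1)) ∞ X] in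
/-- A continuous nonnegative function vanishing exactly on a closed set `Z` of a compact space is
small only near `Z`: for every open `W ⊇ Z` there is `ε₁ > 0` with `{ρ < ε₁} ⊆ W`. [folklore] -/
theorem exists_sublevel_subset {ρ : X → ℝ} (hρc : Continuous ρ) (hρ0 : ∀ x, 0 ≤ ρ x)
    {Z W : Set X} (hZ : ∀ x, ρ x = 0 → x ∈ Z) (hW : IsOpen W) (hZW : Z ⊆ W) :
    ∃ ε₁ : ℝ, 0 < ε₁ ∧ ∀ x, ρ x < ε₁ → x ∈ W := by
  have hK : IsCompact Wᶜ := hW.isClosed_compl.isCompact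
  by_cases hne : (Wᶜ : Set X).Nonempty
  · obtain ⟨x₁, hx₁, hmin⟩ := hK.exists_isMinOn hne hρc.continuousOn
    have hpos : 0 < ρ x₁ := lt_of_le_of_ne (hρ0 x₁) fun h0 ↦ hx₁ (hZW (hZ x₁ h0.symm))
    refine ⟨ρ x₁, hpos, fun x hx ↦ ?_⟩
    by_contra hxW
    exact absurd (hmin (show x ∈ Wᶜ from hxW)) (not_le.2 hx)
  · refine ⟨1, one_pos, fun x _ ↦ ?_⟩
    by_contra hxW
    exact hne ⟨x, hxW⟩

/-- **Convexity near infinity of a non-trapping asymptotically hyperbolic manifold** (GGSU 2019,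
p. 10: "the regions `{ρ ≥ ε}` are strictly convex with respect to the flow for `ε > 0` small
enough"). In the setting of the named fact (smooth Riemannian `g` on `N`, `j : N → X` a smooth
embedding onto the interior of the compact manifold with boundary `X`, boundary `ι(B) = ∂X`,
boundary defining function `ρ ≥ 0` with `|dρ|_ḡ = 1` on `∂X`, `j^* ḡ = (ρ ∘ j)² g`): there is
`ε₀ > 0` such that for every `g`-geodesic `γ` and every `t₀` with `g(γ' t₀, γ' t₀) = 1`,
`ρ(j(γ t₀)) < ε₀` and `(ρ ∘ j ∘ γ)'(t₀) = 0`, one has `(ρ ∘ j ∘ γ)''(t₀) < 0`.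
[cite: GrahamEtAl2020, p. 10] -/
theorem exists_convexity_threshold
    (G : PseudoRiemannianMetric (𝓡 (n + 1)) ∞ (EuclideanSpace ℝ (Fin (n + 1)))
      (TangentSpace (𝓡 (n + 1)) : N → Type _)) [G.HasLeviCivita]
    [CovariantDerivative.ContMDiffCovariantDerivative G.leviCivita 1]
    (gb : PseudoRiemannianMetric (𝓡∂ (n + 1)) ∞ (EuclideanSpace ℝ (Fin (n + 1)))
      (TangentSpace (𝓡∂ (n + 1)) : X → Type _)) (hgb : gb.IsRiemannian)
    {j : N → X} (hj : Manifold.IsSmoothEmbedding (𝓡 (n + 1)) (𝓡∂ (n + 1)) ∞ j)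
    (hjr : range j = (𝓡∂ (n + 1)).interior X)
    {ρ : X → ℝ} (hρ : ContMDiff (𝓡∂ (n + 1)) 𝓘(ℝ, ℝ) ∞ ρ) (hρ0 : ∀ x, 0 ≤ ρ x)
    (hρb : ∀ x, ρ x = 0 ↔ x ∈ (𝓡∂ (n + 1)).boundary X)
    (hconf : ∀ (x : N) (v w : TangentSpace (𝓡 (n + 1)) x),
      gb.val (j x) (mfderiv (𝓡 (n + 1)) (𝓡∂ (n + 1)) j x v) (mfderiv (𝓡 (n + 1)) (𝓡∂ (n + 1)) j x w)
        = ρ (j x) ^ 2 * G.val x v w)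
    {B : Type*} (ι : B → X) (hιr : range ι = (𝓡∂ (n + 1)).boundary X)
    (hν : ∀ y : B, ∃ ν : TangentSpace (𝓡∂ (n + 1)) (ι y), gb.val (ι y) ν ν = 1 ∧
      ∀ a : TangentSpace (𝓡∂ (n + 1)) (ι y), gb.val (ι y) ν a = mfderiv (𝓡∂ (n + 1)) 𝓘(ℝ, ℝ) ρ (ι y) a) :
    ∃ ε₀ : ℝ, 0 < ε₀ ∧ ∀ γ : ℝ → N, IsGeodesic G.leviCivita γ → ∀ t₀ : ℝ,
        G.val (γ t₀) (velocity (𝓡 (n + 1)) γ t₀) (velocity (𝓡 (n + 1)) γ t₀) = 1 →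
        ρ (j (γ t₀)) < ε₀ → deriv (fun t ↦ ρ (j (γ t))) t₀ = 0 →
        deriv (deriv fun t ↦ ρ (j (γ t))) t₀ < 0 := by
  classical
  set I' := 𝓡∂ (n + 1) with hI'
  -- the local statement at every boundary point
  have key : ∀ b : X, b ∈ I'.boundary X → ∃ (V : Set X) (κ : ℝ), IsOpen V ∧ b ∈ V ∧ 0 < κ ∧
      ∀ γ : ℝ → N, IsGeodesic G.leviCivita γ → ∀ t₀ : ℝ, j (γ t₀) ∈ V →
        G.val (γ t₀) (velocity (𝓡 (n + 1)) γ t₀) (velocity (𝓡 (n + 1)) γ t₀) = 1 →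
        ρ (j (γ t₀)) < κ → deriv (fun t ↦ ρ (j (γ t))) t₀ = 0 →
        deriv (deriv fun t ↦ ρ (j (γ t))) t₀ < 0 := by
    intro b hb
    rw [← hιr] at hb
    obtain ⟨y, rfl⟩ := hb
    obtain ⟨ν, hν1, hν2⟩ := hν y
    obtain ⟨V, hVo, hbV, κ, hκ, hP⟩ :=
      convexity_near_point G gb hgb hj hjr hρ hρ0 hρb hconf hν1 hν2
    exact ⟨V, κ, hVo, hbV, hκ, hP⟩
  choose! V κ hVo hbV hκ hP using key
  -- a finite subcover of the compact boundary
  have hbc : IsCompact (I'.boundary X) :=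
    (ModelWithCorners.isClosed_boundary (I := I') (M := X) (n := ∞) (by simp)).isCompact
  obtain ⟨T, hTb, hcover⟩ := hbc.elim_nhds_subcover V fun b hb ↦ (hVo b hb).mem_nhds (hbV b hb)
  set W : Set X := ⋃ b ∈ T, V b with hW
  have hWo : IsOpen W := isOpen_biUnion fun b hb ↦ hVo b (hTb b hb)
  -- `{ρ < ε₁} ⊆ W`
  obtain ⟨ε₁, hε₁, hε₁W⟩ := exists_sublevel_subset hρ.continuous hρ0
    (fun x hx ↦ (hρb x).1 hx) hWo hcover
  -- the threshold
  set S₀ : Finset ℝ := insert ε₁ (T.image κ) with hS₀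
  have hS₀ne : S₀.Nonempty := ⟨ε₁, Finset.mem_insert_self _ _⟩
  set ε₀ : ℝ := S₀.min' hS₀ne with hε₀
  have hε₀pos : 0 < ε₀ := by
    have hmem := S₀.min'_mem hS₀ne
    rw [← hε₀, hS₀, Finset.mem_insert, Finset.mem_image] at hmem
    rcases hmem with h | ⟨b, hb, h⟩
    · rw [h]; exact hε₁
    · rw [← h]; exact hκ b (hTb b hb)
  have hε₀₁ : ε₀ ≤ ε₁ := S₀.min'_le ε₁ (Finset.mem_insert_self _ _)
  have hε₀κ : ∀ b ∈ T, ε₀ ≤ κ b := fun b hb ↦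
    S₀.min'_le _ (Finset.mem_insert_of_mem (Finset.mem_image_of_mem κ hb))
  refine ⟨ε₀, hε₀pos, fun γ hγ t₀ hunit hlt htan ↦ ?_⟩
  have hxW : j (γ t₀) ∈ W := hε₁W _ (hlt.trans_le hε₀₁)
  rw [hW, mem_iUnion₂] at hxW
  obtain ⟨b, hbT, hxV⟩ := hxW
  exact hP b (hTb b hbT) γ hγ t₀ hxV hunit (hlt.trans_le (hε₀κ b hbT)) htan

end Global

end SimpleAH

end Literature.Geometry.Riemannian

end
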